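import Summits.ABC.IUTFork.Cor312LicenceWildInhabitedTriple
import Literature.Barriers.ABC.ExplicitABCQualityFloor
import HarnessLib

/-!
# Arithmetic of the Reyssat triple `2 + 3¹⁰·109 = 23⁵` for the M-shallowness row «W:M-SHALLOW-REYSSAT» (prime divisors, `v_p(abc)`, `ord_p j(2/23⁵)`)

PROOF-ONLY support file (no `def`, no new `Prop`, no instance) of the abc-iut cell (D-0079 R-W numerics crew seat abc-iut-W-num-6, gen 2): closed integer facts
about `abc = 2·3¹⁰·109·23⁵` (its prime divisors; `v₃ = 10`, `v₂₃ = 5`, `v₁₀₉ = 1`, `v₂((abc)²) = 2` by `Nat.Prime.pow_dvd_iff_le_factorization` + `norm_num`) and the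
order of `j(2/23⁵) = 2⁸(cb + a²)³/(abc)²` at the places of `ℚ` (abc-iut-W-neg-1 / abc-iut-W-ref-2's `Cor22.ord_jInv_ratPoint_triple_eq`, abc-iut-S6's
`Cor22.jInv_ratPoint_triple`): `−2·v_p(abc)` at an odd `p ∣ abc`, `≥ −2` at `2`. Consumed by `AbcOfSHwBadMReyssatShallow`. TAKES NO SIDE on [IUTchIII] Cor. 3.12;
typed ≠ proved; no abc claim. [cite: SilvermanAEC2009, Prop. III.1.7(b)] [cite: Mochizuki2012, IUTchIV Cor. 2.2 (ii) proof p. 44] [claim: Mochizuki2012, status: disputed]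
-/

noncomputable section

open Set Function NumberField IsDedekindDomain

namespace Summit.ABC.IUTFork.Conditional

open Thm311 Thm311.Real Cor312 Cor312Vol Cor312Prov Literature.IUT.LogThetaLattice Literature.IUT.LogVolume
  Literature.IUT.HodgeTheaters Literature.IUT.LogVolume.ThetaData Literature.IUT.LogVolume.Cor22
open Literature.NumberTheory.NumberFields Literature.NumberTheory.GaloisRepresentations.Ultrametric
open Literature.NumberTheory.DiophantineGeometry Literature.NumberTheory.DiophantineGeometry.GenEll Summit.ABC.ABC.Theorems

/-! ## §0. Arithmetic of the Reyssat triple `2 + 3¹⁰·109 = 23⁵` -/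

/-- Prime divisors of `2·3¹⁰·109·23⁵`. [folklore] -/
theorem MShallowReyssat.eq_of_prime_dvd {p : ℕ} (hp : p.Prime) (h : p ∣ 2 * (3 ^ 10 * 109) * 23 ^ 5) :
    p = 2 ∨ p = 3 ∨ p = 109 ∨ p = 23 := by
  rcases (Nat.Prime.dvd_mul hp).1 h with h1 | h23
  · rcases (Nat.Prime.dvd_mul hp).1 h1 with h2 | h3109
    · exact Or.inl ((Nat.prime_dvd_prime_iff_eq hp Nat.prime_two).1 h2)
    · rcases (Nat.Prime.dvd_mul hp).1 h3109 with h3 | h109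
      · exact Or.inr (Or.inl ((Nat.prime_dvd_prime_iff_eq hp Nat.prime_three).1 (hp.dvd_of_dvd_pow h3)))
      · exact Or.inr (Or.inr (Or.inl ((Nat.prime_dvd_prime_iff_eq hp (by norm_num)).1 h109)))
  · exact Or.inr (Or.inr (Or.inr ((Nat.prime_dvd_prime_iff_eq hp (by norm_num)).1 (hp.dvd_of_dvd_pow h23))))

/-- `v₃(abc) = 10`. [folklore] -/
theorem MShallowReyssat.factorization_three : (2 * (3 ^ 10 * 109) * 23 ^ 5).factorization 3 = 10 := by
  have h1 : 10 ≤ (2 * (3 ^ 10 * 109) * 23 ^ 5).factorization 3 :=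
    (Nat.prime_three.pow_dvd_iff_le_factorization (by norm_num)).1 (by norm_num)
  have h2 : ¬ 11 ≤ (2 * (3 ^ 10 * 109) * 23 ^ 5).factorization 3 := fun h =>
    absurd ((Nat.prime_three.pow_dvd_iff_le_factorization (by norm_num)).2 h) (by norm_num)
  omega

/-- `v₂₃(abc) = 5`. [folklore] -/
theorem MShallowReyssat.factorization_twentythree : (2 * (3 ^ 10 * 109) * 23 ^ 5).factorization 23 = 5 := by
  have hp : Nat.Prime 23 := by norm_num
  have h1 : 5 ≤ (2 * (3 ^ 10 * 109) * 23 ^ 5).factorization 23 := (hp.pow_dvd_iff_le_factorization (by norm_num)).1 (by norm_num)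
  have h2 : ¬ 6 ≤ (2 * (3 ^ 10 * 109) * 23 ^ 5).factorization 23 := fun h =>
    absurd ((hp.pow_dvd_iff_le_factorization (by norm_num)).2 h) (by norm_num)
  omega

/-- `v₁₀₉(abc) = 1`. [folklore] -/
theorem MShallowReyssat.factorization_hundrednine : (2 * (3 ^ 10 * 109) * 23 ^ 5).factorization 109 = 1 := by
  have hp : Nat.Prime 109 := by norm_num
  have h1 : 1 ≤ (2 * (3 ^ 10 * 109) * 23 ^ 5).factorization 109 := (hp.pow_dvd_iff_le_factorization (by norm_num)).1 (by norm_num)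
  have h2 : ¬ 2 ≤ (2 * (3 ^ 10 * 109) * 23 ^ 5).factorization 109 := fun h =>
    absurd ((hp.pow_dvd_iff_le_factorization (by norm_num)).2 h) (by norm_num)
  omega

/-- `v₂((abc)²) = 2`. [folklore] -/
theorem MShallowReyssat.factorization_sq_two : ((2 * (3 ^ 10 * 109) * 23 ^ 5) ^ 2).factorization 2 = 2 := by
  have h1 : 2 ≤ ((2 * (3 ^ 10 * 109) * 23 ^ 5) ^ 2).factorization 2 :=
    (Nat.prime_two.pow_dvd_iff_le_factorization (by norm_num)).1 (by norm_num)
  have h2 : ¬ 3 ≤ ((2 * (3 ^ 10 * 109) * 23 ^ 5) ^ 2).factorization 2 := fun h =>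
    absurd ((Nat.prime_two.pow_dvd_iff_le_factorization (by norm_num)).2 h) (by norm_num)
  omega

/-- `ord_v j(2/23⁵)` at the place over an odd prime divisor `p` of `abc`: `−2·v_p(abc)`. [cite: SilvermanAEC2009, Prop. III.1.7(b)] -/
theorem MShallowReyssat.ord_jInv_of_eq (W : HeightOneSpectrum (𝓞 ℚ)) {p : ℕ} (hW : Rat.HeightOneSpectrum.natGenerator W = p)
    (hp2 : p ≠ 2) (hdvd : p ∣ 2 * (3 ^ 10 * 109) * 23 ^ 5) :
    Literature.IUT.LogVolume.ord ℚ W (Cor22.jInv (((2 : ℕ) : ℚ) / (23 ^ 5 : ℕ))) = -(2 * (((2 * (3 ^ 10 * 109) * 23 ^ 5).factorization p : ℕ) : ℤ)) := by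
  have h := Cor22.ord_jInv_ratPoint_triple_eq Literature.Barriers.ABC.reyssat_isABCTriple W (by rw [hW]; exact hp2)
    (by rw [hW]; exact hdvd)
  rw [hW] at h
  exact_mod_cast h

/-- `ord_v j(2/23⁵) ≥ −2` at the place over `2` (`j = 2⁸(cb + a²)³/(abc)²`, `v₂((abc)²) = 2`). [cite: SilvermanAEC2009, Prop. III.1.7(b)] -/
theorem MShallowReyssat.neg_two_le_ord_jInv_two (W : HeightOneSpectrum (𝓞 ℚ)) (hW : Rat.HeightOneSpectrum.natGenerator W = 2) :
    -2 ≤ Literature.IUT.LogVolume.ord ℚ W (Cor22.jInv (((2 : ℕ) : ℚ) / (23 ^ 5 : ℕ))) := by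
  have habc := Literature.Barriers.ABC.reyssat_isABCTriple
  have hN0 : 256 * (23 ^ 5 * (3 ^ 10 * 109) + 2 * 2) ^ 3 ≠ 0 := by positivity
  have hN0' : ((256 * (23 ^ 5 * (3 ^ 10 * 109) + 2 * 2) ^ 3 : ℕ) : ℚ) ≠ 0 := by exact_mod_cast hN0
  have hD0 : (2 * (3 ^ 10 * 109) * 23 ^ 5) ^ 2 ≠ 0 := by positivity
  have hD0' : (((2 * (3 ^ 10 * 109) * 23 ^ 5) ^ 2 : ℕ) : ℚ) ≠ 0 := by exact_mod_cast hD0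
  rw [Cor22.jInv_ratPoint_triple habc, div_eq_mul_inv, ord_mul ℚ W hN0' (inv_ne_zero hD0'), ord_inv,
    Cor22.ord_natCast_eq_factorization W hN0, Cor22.ord_natCast_eq_factorization W hD0, hW, MShallowReyssat.factorization_sq_two]
  have : (0 : ℤ) ≤ ((256 * (23 ^ 5 * (3 ^ 10 * 109) + 2 * 2) ^ 3).factorization 2 : ℕ) := by positivity
  push_cast
  linarith

end Summit.ABC.IUTFork.Conditional

end
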